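import Summits.BirchSwinnertonDyer.BirchSwinnertonDyer.Theorems.ResidualThetaTransportAtTwoKatoZetaDefs
import Summits.BirchSwinnertonDyer.BirchSwinnertonDyer.Theorems.ResidualThetaTransportAtTwoResidualSignedLambdaLowerCMAtTwoFourTermOneSided
import HarnessLib

/-!
# Sketch (stub-ideation k4 · g27, «assume the opposite») — the `∀`-clause of KZ_g child B under the REGISTERED multiplier form of (R)

Crux `ResidualThetaCountLowerPureAtTwo` (stmt-BirchSwinnertonDyer-26074), stub `stub_cmLambdaLower` = RSL_g (stmt-22608), line `onepair` v3g.
THEOREMS ONLY (no `def`, no `instance`, no notation, no `sorry`). Nothing about curves or forms is asserted; BSD is proved for no curve;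
22608 / 26074 / 24105 stay OPEN / HOLD. `Cruxes/` is not importable: port-on-consumption only (T75).

* §A  λ-bookkeeping of TWO valued classes when (R) is in multiplier form `C ν · e(𝒸 z) = μt · (Lm · u)` with `u ≠ 0` free
      (critic T80 / S136 (2)): the class-independent quantity is `λ(𝐇¹/Λz) − λ(Λ/μt) − λ(Λ/u)` (A3), NOT child B's slack
      `λ(𝐇¹/Λz) − λ(Λ/μt)`; child B transfers from one valued class to another iff `λ(Λ/u)` does not jump (A4/A5).
* §B  the quantifier shape: the landed glue consumes child B only at child A's witness, so the MERGED `∃∧` text is weaker than the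
      registered pair (A `∃`, B `∀`) and still feeds the interior assembly.
* §C  the missing station, typed over the pins: SLACK INVARIANCE of valued classes ⇒ (child B at one valued class ⇒ child B `∀`).
-/

set_option autoImplicit false
set_option linter.dupNamespace false

noncomputable section

open scoped TensorProduct Classical

namespace Summit.BirchSwinnertonDyer.BirchSwinnertonDyer.Cruxes.ResidualThetaCountLowerPureAtTwo.SideaK4G27

universe u w

/-! ## §A  Two valued classes under the multiplier form of (R): which λ-quantity is class-independent -/

section Lambda

open Summit.BirchSwinnertonDyer.BirchSwinnertonDyer.Theorems

variable {A : Type u} [CommRing A] [IsDomain A] [IsDiscreteValuationRing A]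
  [IsAdicComplete (IsLocalRing.maximalIdeal A) A]
variable (K : Type w) [Field K] [Algebra A K] [IsFractionRing A K]

omit [IsDomain A] [IsDiscreteValuationRing A] [IsAdicComplete (IsLocalRing.maximalIdeal A) A] [IsFractionRing A K] in
/-- **A1. Units are λ-invisible**: `λ(Λ/(v)) = 0` for a unit `v ∈ Λ = A⟦X⟧`. [folklore] -/
theorem finrank_baseChange_quotient_span_eq_zero_of_isUnit {v : PowerSeries A} (hv : IsUnit v) :
    Module.finrank K (K ⊗[A] (PowerSeries A ⧸ Ideal.span {v})) = 0 := by
  haveI : Subsingleton (PowerSeries A ⧸ Ideal.span {v}) :=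
    Ideal.Quotient.subsingleton_iff.mpr (Ideal.span_singleton_eq_top.mpr hv)
  have hx : ∀ t : K ⊗[A] (PowerSeries A ⧸ Ideal.span {v}), t = 0 := fun t ↦ by
    induction t using TensorProduct.induction_on with
    | zero => rfl
    | tmul a m => rw [Subsingleton.elim m 0, TensorProduct.tmul_zero]
    | add a b ha hb => rw [ha, hb, add_zero]
  haveI : Subsingleton (K ⊗[A] (PowerSeries A ⧸ Ideal.span {v})) := ⟨fun x y ↦ by rw [hx x, hx y]⟩
  exact Module.finrank_zero_of_subsingleton

/-- **A2. The two-class identity in `Λ` and its λ-count.** Two valued classes on one `Λ`-line (`r·E₁ = v·s·E₂`, `v` a unit — the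
ratio of two admissible trivialisations, critic S158) each obeying the REGISTERED (R) `C νᵢ · Eᵢ = μᵢ · (Lm · uᵢ)` force
`C ν₂ · r · μ₁ · u₁ = C ν₁ · v · s · μ₂ · u₂` (cancel `Lm ≠ 0`), hence `λ(r) + λ(μ₁) + λ(u₁) = λ(s) + λ(μ₂) + λ(u₂)`.
[cite: Washington1997, §13.2] [cite: Kato2004Asterisque, Thm. 12.5 (1) (p. 221)] -/
theorem lam_add_eq_of_twoClass_multiplierForm {ν₁ ν₂ : A} (hν₁ : ν₁ ≠ 0) (hν₂ : ν₂ ≠ 0)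
    {E₁ E₂ Lm μ₁ μ₂ u₁ u₂ r s v : PowerSeries A} (hLm : Lm ≠ 0) (hμ₁ : μ₁ ≠ 0) (hμ₂ : μ₂ ≠ 0)
    (hu₁ : u₁ ≠ 0) (hu₂ : u₂ ≠ 0) (hr : r ≠ 0) (hs : s ≠ 0) (hv : IsUnit v)
    (h₁ : PowerSeries.C ν₁ * E₁ = μ₁ * (Lm * u₁)) (h₂ : PowerSeries.C ν₂ * E₂ = μ₂ * (Lm * u₂))
    (hE : r * E₁ = v * (s * E₂)) :
    Module.finrank K (K ⊗[A] (PowerSeries A ⧸ Ideal.span {r})) +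
        Module.finrank K (K ⊗[A] (PowerSeries A ⧸ Ideal.span {μ₁})) +
        Module.finrank K (K ⊗[A] (PowerSeries A ⧸ Ideal.span {u₁})) =
      Module.finrank K (K ⊗[A] (PowerSeries A ⧸ Ideal.span {s})) +
        Module.finrank K (K ⊗[A] (PowerSeries A ⧸ Ideal.span {μ₂})) +
        Module.finrank K (K ⊗[A] (PowerSeries A ⧸ Ideal.span {u₂})) := by
  have hCν₁ : (PowerSeries.C ν₁ : PowerSeries A) ≠ 0 := fun h0 ↦ hν₁ (by simpa using congrArg PowerSeries.constantCoeff h0)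
  have hCν₂ : (PowerSeries.C ν₂ : PowerSeries A) ≠ 0 := fun h0 ↦ hν₂ (by simpa using congrArg PowerSeries.constantCoeff h0)
  have hv0 : v ≠ 0 := hv.ne_zero
  -- the two-class identity, `Lm` cancelled
  have key : PowerSeries.C ν₂ * (r * (μ₁ * u₁)) * Lm = PowerSeries.C ν₁ * (v * (s * (μ₂ * u₂))) * Lm := by
    linear_combination (PowerSeries.C ν₁ * PowerSeries.C ν₂) * hE + (PowerSeries.C ν₁ * v * s) * h₂
      - (PowerSeries.C ν₂ * r) * h₁
  have key' : PowerSeries.C ν₂ * (r * (μ₁ * u₁)) = PowerSeries.C ν₁ * (v * (s * (μ₂ * u₂))) :=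
    mul_right_cancel₀ hLm key
  -- λ of both sides
  have h11 : μ₁ * u₁ ≠ 0 := mul_ne_zero hμ₁ hu₁
  have h12 : r * (μ₁ * u₁) ≠ 0 := mul_ne_zero hr h11
  have h21 : μ₂ * u₂ ≠ 0 := mul_ne_zero hμ₂ hu₂
  have h22 : s * (μ₂ * u₂) ≠ 0 := mul_ne_zero hs h21
  have h23 : v * (s * (μ₂ * u₂)) ≠ 0 := mul_ne_zero hv0 h22
  have lhs : Module.finrank K (K ⊗[A] (PowerSeries A ⧸ Ideal.span {PowerSeries.C ν₂ * (r * (μ₁ * u₁))})) =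
      Module.finrank K (K ⊗[A] (PowerSeries A ⧸ Ideal.span {r})) +
        Module.finrank K (K ⊗[A] (PowerSeries A ⧸ Ideal.span {μ₁})) +
        Module.finrank K (K ⊗[A] (PowerSeries A ⧸ Ideal.span {u₁})) := by
    rw [CharIdealLambda.finrank_baseChange_quotient_span_C_mul_eq K hν₂ h12,
      CharIdealLambda.finrank_baseChange_quotient_span_mul_eq_add K hr h11,
      CharIdealLambda.finrank_baseChange_quotient_span_mul_eq_add K hμ₁ hu₁]
    omega
  have rhs : Module.finrank K (K ⊗[A] (PowerSeries A ⧸ Ideal.span {PowerSeries.C ν₁ * (v * (s * (μ₂ * u₂)))})) =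
      Module.finrank K (K ⊗[A] (PowerSeries A ⧸ Ideal.span {s})) +
        Module.finrank K (K ⊗[A] (PowerSeries A ⧸ Ideal.span {μ₂})) +
        Module.finrank K (K ⊗[A] (PowerSeries A ⧸ Ideal.span {u₂})) := by
    rw [CharIdealLambda.finrank_baseChange_quotient_span_C_mul_eq K hν₁ h23,
      CharIdealLambda.finrank_baseChange_quotient_span_mul_eq_add K hv0 h22,
      finrank_baseChange_quotient_span_eq_zero_of_isUnit K hv,
      CharIdealLambda.finrank_baseChange_quotient_span_mul_eq_add K hs h21,
      CharIdealLambda.finrank_baseChange_quotient_span_mul_eq_add K hμ₂ hu₂]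
    omega
  rw [← lhs, ← rhs, key']

/-- **A3. The class-independent quantity is `λ(H/Λz) − λ(μ) − λ(u)`, not child B's slack `λ(H/Λz) − λ(μ)`.** For `z₁, z₂ ∈ H`
(`= 𝐇¹`) without `Λ`-torsion, torsion zeta quotients, commensurable (`r•z₁ = s•z₂`, Kato 12.4: rank one), and the Λ-side count of A2:
`λ(H/Λz₁) + λ(μ₂) + λ(u₂) = λ(H/Λz₂) + λ(μ₁) + λ(u₁)`. (k1-g25 K5 is the case `u₁ = u₂ = 1`.)
[cite: Kato2004Asterisque, Thm. 12.4 (2) (p. 221)] [cite: Washington1997, §13.2] -/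
theorem slack_identity_of_twoClass {H : Type u} [AddCommGroup H] [Module (PowerSeries A) H] [Module A H]
    [IsScalarTower A (PowerSeries A) H] [Module.Finite (PowerSeries A) H]
    {z₁ z₂ : H} (hz₁ : ∀ a : PowerSeries A, a • z₁ = 0 → a = 0) (hz₂ : ∀ a : PowerSeries A, a • z₂ = 0 → a = 0)
    (ht₁ : Module.IsTorsion (PowerSeries A) (H ⧸ Submodule.span (PowerSeries A) {z₁}))
    (ht₂ : Module.IsTorsion (PowerSeries A) (H ⧸ Submodule.span (PowerSeries A) {z₂}))
    {r s μ₁ μ₂ u₁ u₂ : PowerSeries A} (hr : r ≠ 0) (hs : s ≠ 0) (hcomm : r • z₁ = s • z₂)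
    (hΛ : Module.finrank K (K ⊗[A] (PowerSeries A ⧸ Ideal.span {r})) +
        Module.finrank K (K ⊗[A] (PowerSeries A ⧸ Ideal.span {μ₁})) +
        Module.finrank K (K ⊗[A] (PowerSeries A ⧸ Ideal.span {u₁})) =
      Module.finrank K (K ⊗[A] (PowerSeries A ⧸ Ideal.span {s})) +
        Module.finrank K (K ⊗[A] (PowerSeries A ⧸ Ideal.span {μ₂})) +
        Module.finrank K (K ⊗[A] (PowerSeries A ⧸ Ideal.span {u₂}))) :
    Module.finrank K (K ⊗[A] (H ⧸ Submodule.span (PowerSeries A) {z₁})) +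
        Module.finrank K (K ⊗[A] (PowerSeries A ⧸ Ideal.span {μ₂})) +
        Module.finrank K (K ⊗[A] (PowerSeries A ⧸ Ideal.span {u₂})) =
      Module.finrank K (K ⊗[A] (H ⧸ Submodule.span (PowerSeries A) {z₂})) +
        Module.finrank K (K ⊗[A] (PowerSeries A ⧸ Ideal.span {μ₁})) +
        Module.finrank K (K ⊗[A] (PowerSeries A ⧸ Ideal.span {u₁})) := by
  have e₁ := CharIdealLambda.finrank_baseChange_quotient_span_smul_eq_add K z₁ hz₁ r hr ht₁
  have e₂ := CharIdealLambda.finrank_baseChange_quotient_span_smul_eq_add K z₂ hz₂ s hs ht₂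
  rw [hcomm] at e₁
  omega

/-- **A4. Child B TRANSFERS between valued classes iff `λ(u)` does not jump.** With A3's identity: if `λ(u₁) ≤ λ(u₂)` then
(ii_λ) at class 2 gives (ii_λ) at class 1 (same `X₀`). [cite: BurungaleTian2026, Thm. 2.6] [cite: Kato2004Asterisque, Thm. 12.5 (2)] -/
theorem childB_transfer_of_lam_u_le {hz₁ hz₂ μ₁ μ₂ u₁ u₂ X0 : ℕ}
    (hid : hz₁ + μ₂ + u₂ = hz₂ + μ₁ + u₁) (hu : u₁ ≤ u₂) (hB₂ : hz₂ ≤ X0 + μ₂) : hz₁ ≤ X0 + μ₁ := by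
  omega

/-- **A5. The opposite is consistent exactly when `λ(u)` jumps**: with A3's identity, a jump `λ(u₁) − λ(u₂)` exceeding the room
`X₀ + λ(μ₂) − λ(H/Λz₂)` left by (ii_λ) at class 2 makes (ii_λ) FAIL at class 1 — the registered (R) (`u ≠ 0` only, T80) does not
exclude this by itself. [cite: Kato2004Asterisque, Thm. 12.5 (1)(2)] -/
theorem childB_fails_of_lam_u_jump {hz₁ hz₂ μ₁ μ₂ u₁ u₂ X0 : ℕ}
    (hid : hz₁ + μ₂ + u₂ = hz₂ + μ₁ + u₁) (hjump : X0 + μ₂ + u₂ < hz₂ + u₁) : X0 + μ₁ < hz₁ := by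
  omega

end Lambda

/-! ## §B  Quantifier shape: the MERGED `∃∧` text is weaker than (A `∃`, B `∀`) and feeds the same assembly -/

section Shape

variable {Fr Tup : Type*} {V I Bc : Fr → Tup → Prop}

/-- **B1.** The registered pair (child A `∃`, child B `∀ valued`) implies the merged text `∀ F, ∃ t, V F t ∧ B F t`. [folklore] -/
theorem merged_of_split (hA : ∀ F, ∃ t, V F t) (hB : ∀ F t, V F t → Bc F t) : ∀ F, ∃ t, V F t ∧ Bc F t :=
  fun F ↦ (hA F).elim fun t ht ↦ ⟨t, ht, hB F t ht⟩

/-- **B2.** The merged text suffices for the interior assembly: with the (i)-half `∀ F t, V F t → I F t` (landed `KZgGlue.iHalf_of_stations`,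
used at the witness exactly as in `KZgGlue.katoZetaCMAtTwo_of_iHalf` ll. 117–121) one gets `∃ t, V ∧ I ∧ B`. [folklore] -/
theorem interior_of_merged (hI : ∀ F t, V F t → I F t) (hAB : ∀ F, ∃ t, V F t ∧ Bc F t) :
    ∀ F, ∃ t, V F t ∧ I F t ∧ Bc F t :=
  fun F ↦ (hAB F).elim fun t ht ↦ ⟨t, ht.1, hI F t ht.1, ht.2⟩

end Shape

/-! ## §C  The missing station, typed over the one-pair pins: SLACK INVARIANCE ⇒ child B `∀` from child B at ONE valued class -/

section Station

open Summit.BirchSwinnertonDyer.BirchSwinnertonDyer.Theorems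
open Summit.BirchSwinnertonDyer.BirchSwinnertonDyer.Theorems.OnePair
open Literature.NumberTheory.EllipticCurves Literature.NumberTheory.EllipticCurves.GreenbergSelmer
open Literature.NumberTheory.GaloisRepresentations NumberField IsDedekindDomain Field
open GreenbergVatsal2000 Kobayashi2003 Rat.HeightOneSpectrum PowerSeries
open Summit.BirchSwinnertonDyer.Rank1Residual.Additive Summit.BirchSwinnertonDyer.Rank1Residual.Additive.PadicCyclotomicTower

variable {S : Set (PadicAlgCl 2)} {W : WeierstrassCurve ℚ} [W.IsElliptic] {κ : ZpExtension ℚ 2} {γ : absoluteGaloisGroup ℚ}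
  {S₀ : Finset (HeightOneSpectrum (𝓞 ℚ))} {n : ℕ} {ρ : FramedGaloisRep ℚ ↥(padicCoeffIntegers S) 2}
  {Θ : ∀ v : HeightOneSpectrum (𝓞 ℚ), ((2 : ℕ) : 𝓞 ℚ) ∈ v.asIdeal → (Cofree ρ ↥(padicCoeffField S) ≃+ (Fin n → ↥(W.geomPrimaryTorsion 2)))}
  {hΘ : ∀ v hv (δ : absoluteGaloisGroup (v.adicCompletion ℚ)) m i,
    Θ v hv (resGalOfEmb (closureEmb (K := ℚ) (v.adicCompletion ℚ)) δ • m) i = resGalOfEmb (closureEmb (K := ℚ) (v.adicCompletion ℚ)) δ • Θ v hv m i}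
  {I : Kato2004.IwasawaH1DataCoeff (FramedGaloisRep.toGaloisRep ρ) 2 κ γ}
  {Sg : AddSubgroup (subgroupH1 κ.kerSubgroup (Cofree ρ ↥(padicCoeffField S)))} [Module ↥(padicCoeffIntegers S) ↥Sg]
  [Module ↥(padicCoeffIntegers S) I.H] [IsScalarTower ↥(padicCoeffIntegers S) (IwasawaAlgebraO S) I.H]
  (π : OnePairPins S W κ γ S₀ n ρ Θ hΘ I Sg)

/-- **C1 (station (B≡), SLACK INVARIANCE ⇒ child B `∀`).** If, at a frame `F`, any two valued classes have the same slack-corrected count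
`λ_𝒪(𝐇¹/Λz) − λ_𝒪(Λ/(μt))` (hypothesis `hInv`, the station this sketch isolates), then child B's (ii_λ) at ONE valued class gives it at EVERY
valued class — i.e. child B's `∀`-form is the print statement about Kato's class plus exactly `hInv`. (`X0` stands for `λ_𝒪(Sel₀^∨)`.)
[cite: Kato2004Asterisque, Thm. 12.5 (1)(2), 12.6 (pp. 221–222)] [cite: BurungaleTian2026, Thm. 2.6] -/
theorem childB_forall_of_slackInvariant [W.IsGloballyMinimal] {M : ℕ} [NeZero M] (g : CuspForm (CongruenceSubgroup.Gamma0 M) 2)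
    (ι : ModularForms.coeffField g →+* PadicAlgCl 2) (Ω : ℂ) (F : π.KatoFrame) (X0 : ℕ)
    (hInv : ∀ (z₁ : I.H) (c₁ : Fin n → ↥(padicCoeffIntegers S)) (w₁ : ℕ → Fin π.nb → PadicAlgCl 2) (q₁ : PadicAlgCl 2)
        (μ₁ : IwasawaAlgebraO S) (z₂ : I.H) (c₂ : Fin n → ↥(padicCoeffIntegers S)) (w₂ : ℕ → Fin π.nb → PadicAlgCl 2)
        (q₂ : PadicAlgCl 2) (μ₂ : IwasawaAlgebraO S),
        π.KatoValuedClass g ι Ω F.Φ F.τ z₁ c₁ w₁ q₁ μ₁ → π.KatoValuedClass g ι Ω F.Φ F.τ z₂ c₂ w₂ q₂ μ₂ →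
          lamO S (zetaQuot I z₁) + lamO S (IwasawaAlgebraO S ⧸ Ideal.span {μ₂}) =
            lamO S (zetaQuot I z₂) + lamO S (IwasawaAlgebraO S ⧸ Ideal.span {μ₁}))
    {z₀ : I.H} {c₀ : Fin n → ↥(padicCoeffIntegers S)} {w₀ : ℕ → Fin π.nb → PadicAlgCl 2} {q₀ : PadicAlgCl 2}
    {μ₀ : IwasawaAlgebraO S} (h₀ : π.KatoValuedClass g ι Ω F.Φ F.τ z₀ c₀ w₀ q₀ μ₀)
    (hB₀ : lamO S (zetaQuot I z₀) ≤ X0 + lamO S (IwasawaAlgebraO S ⧸ Ideal.span {μ₀})) :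
    ∀ (z : I.H) (c' : Fin n → ↥(padicCoeffIntegers S)) (w : ℕ → Fin π.nb → PadicAlgCl 2) (q : PadicAlgCl 2)
      (μt : IwasawaAlgebraO S), π.KatoValuedClass g ι Ω F.Φ F.τ z c' w q μt →
        lamO S (zetaQuot I z) ≤ X0 + lamO S (IwasawaAlgebraO S ⧸ Ideal.span {μt}) := by
  intro z c' w q μt h
  have := hInv z c' w q μt z₀ c₀ w₀ q₀ μ₀ h h₀
  omega

/-- **C2 (converse bookkeeping: child B `∀` ⇒ half of slack invariance is NOT implied — only the one-sided bound).** What child B's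
`∀`-form does give between two valued classes is the pair of bounds, nothing tying the two slacks together; recorded to make precise that
(B≡) is extra content relative to the registered texts. [folklore] -/
theorem childB_forall_gives_only_bounds [W.IsGloballyMinimal] {M : ℕ} [NeZero M] (g : CuspForm (CongruenceSubgroup.Gamma0 M) 2)
    (ι : ModularForms.coeffField g →+* PadicAlgCl 2) (Ω : ℂ) (F : π.KatoFrame) (X0 : ℕ)
    (hB : ∀ (z : I.H) (c' : Fin n → ↥(padicCoeffIntegers S)) (w : ℕ → Fin π.nb → PadicAlgCl 2) (q : PadicAlgCl 2)
      (μt : IwasawaAlgebraO S), π.KatoValuedClass g ι Ω F.Φ F.τ z c' w q μt →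
        lamO S (zetaQuot I z) ≤ X0 + lamO S (IwasawaAlgebraO S ⧸ Ideal.span {μt}))
    {z₁ z₂ : I.H} {c₁ c₂ : Fin n → ↥(padicCoeffIntegers S)} {w₁ w₂ : ℕ → Fin π.nb → PadicAlgCl 2} {q₁ q₂ : PadicAlgCl 2}
    {μ₁ μ₂ : IwasawaAlgebraO S} (h₁ : π.KatoValuedClass g ι Ω F.Φ F.τ z₁ c₁ w₁ q₁ μ₁)
    (h₂ : π.KatoValuedClass g ι Ω F.Φ F.τ z₂ c₂ w₂ q₂ μ₂) :
    lamO S (zetaQuot I z₁) + lamO S (zetaQuot I z₂) ≤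
      2 * X0 + lamO S (IwasawaAlgebraO S ⧸ Ideal.span {μ₁}) + lamO S (IwasawaAlgebraO S ⧸ Ideal.span {μ₂}) := by
  have e₁ := hB z₁ c₁ w₁ q₁ μ₁ h₁
  have e₂ := hB z₂ c₂ w₂ q₂ μ₂ h₂
  omega

end Station

end Summit.BirchSwinnertonDyer.BirchSwinnertonDyer.Cruxes.ResidualThetaCountLowerPureAtTwo.SideaK4G27

end
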